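import Summits.BirchSwinnertonDyer.Rank1Residual.ManinAdditive.DegeneracyClassUnitTwist
import HarnessLib
import HarnessLib.Audit.Tags

/-!
# E-es-92 / E-es-93: the EULER-TRANSLATED prime-class degeneracy-loop laws (K₉)♮E₁ / (K₉)♮E — typed, with their
# weight calculus PROVED (es g22 THEOREM U♮E machinery; cell `bsd-f2-manin`, typing asks T-es-29 (h)(h′)(i′), typer g15)

HONEST FRAMING.  LENS = Euler systems / explicit reciprocity (`bsd-f2-manin-es` g22, MEMO-es §36.14–§36.16, «PROVED (3)/(4)/(5)»
2026-08-28T20:38Z–21:00Z).  SOURCE = HOME/es/Sketch-es-g22-thm87.lean sha16 1fa952104aa82908 (2259 l.; farm rc 0 · 0 err ·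
0 warn · 0 sorry; standard axioms es/g22/axiomsE.out, axiomsC.out), VERBATIM: the vocabulary of §E (`eulerFactorTwist`,
`degLoop`, `degeneracyLoopsClassTwoEuler`, `DegeneracyClassEulerPlusIndexPrimeTo`; file lines 1114–1205 without the two
proof-only lemmas), the weight calculus of §EL (`eulerFactorList`, `eulerShift`, `eulerShiftList`, `loopWeight`,
`weightSum_mem_periodLattice`, `degeneracyLoopsClassTwoEulerList`, `DegeneracyClassEulerListPlusIndexPrimeTo`; lines
1437–1632 without the three character-side identities), the two LAWS E-es-92 `DegeneracyClassEulerLawNine` (l. 1347) and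
E-es-93 `DegeneracyClassEulerListLawNine` (l. 1844) now tagged `@[conjecture]`, and the prime-conductor witness
`PrimeThreeAdicPolarWitness` of §WLevelLemmaC (l. 2176); namespace `BsdF2ManinEsG22T` ↦ `…ManinAdditive.KatoCurve` (as for
the sibling leaves `TwistedSymbolFourier` / `DegeneracyClassUnitTwist`, typer g14); ten undocumented helper lemmas received
one-line docstrings.  WHY A NEW LEAF and not `DegeneracyLoopLaws.lean` (es's suggested home): these laws are stated over
`Λ_f`-plus coordinates and cusp values (`KatoCurve.cuspValue`, `TwistedSymbolFourier`), downstream of the Γ₁-side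
`DegeneracyLoopLaws` — the import arrow points the other way.

INFORMAL LAWS.  At a level `9 ∣ N`, for a rational newform `f` with plus index `[Λ_f⁺ : Λ₁⁺]` prime to `3`, the plus parts
of the prime-class (`m ≡ 2 (mod 3)`) ratio-`9` degeneracy loops TRANSLATED by the Euler operator `θ_l` of ONE sharp prime
`l ∥ N` (E-es-92) — resp. by `θ_F = ∏_{q ∥ N} θ_q` for the whole list of sharp primes (E-es-93) — still reach a subgroup
of `tr Λ_f` of index prime to `3` («no E-hole»: mod `3`, `θ_q ≡ −σ_q⁻¹(σ_q − ε_q)²`).  es: E-es-93 specialises on paper to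
E-es-91 (no sharp prime; tree `Gamma1Lattice.DegeneracyClassLoopLawNine`) and to E-es-92 (one sharp prime); NO formal edge
between the three rows is claimed or landed here (different generating sets).  NOTHING IS ASSERTED: both rows are
`@[conjecture]` obligation nodes; everything else in this file is a definition or a SORRY-FREE lemma.

NOT IN PRINT.  Unit twists of `L`-values by tame characters and their integrality are classical (Stevens, Mazur–Tate,
Wiles–Vatsal non-vanishing mod `p`); an f-level LATTICE law making the Euler factor of the sharp primes harmless for the
`3`-adic unit-twist problem of an additive-at-`3` optimal curve is the cell's (es g22), not a published statement.  Nearest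
print BY NAME (es's placement, MEMO-es §36.8 / §36.13 (6), searches run there, both corpora): Stevens 1985 (TAMS 291, «The
cuspidal group and special values of L-functions») and Ash–Stevens 1986 (Duke 53) — mod-𝔭 non-vanishing of twisted special
values with Eisenstein-ideal obstructions, `p ∤ N` type hypotheses (NOT HELD: acq-11413/11414) — and, for the degeneracy
side, Ribet 1984 Thm 4.3 (the Ihara equaliser for `t ∤ N`; tree docstring of `Gamma1Lattice.DegeneracyLoopLaw`).
CONSUMERS (sibling files landing next, same source): THEOREM U♮E `exists_prime_eulerListUnitTwist_of_degeneracyClass`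
(`DegeneracyClassEulerUnitTwist.lean`), the W-level `threeAdicPolarWitness_of_eulerListLawNine` = h66 with additivity
binders at EVERY level `9 ∣ N` from E-es-93 alone (`DegeneracyClassEulerWitnesses.lean`; TURNKEY-es-18/19 for the C3 LEAD),
and LEMMA C `degeneracyClassNineEulerList_iff_primeThreeAdicPolarWitness` (E-es-93 at `D.f` ⟺ `PrimeThreeAdicPolarWitness W D.f`).

BC5 WITNESS (es, in-seat): CENSUS E43 (HOME/es/g22/E43-POLAR-ELAW-CENSUS-v1.txt sha16 5e220a5331b0b08a, from
data/POLAR-N5000-rows-v1.tsv 3b0eeb7a71360859 via LEMMA C): habitat `9 ∣ N ≤ 5000` = 4313 classes (k = number of sharp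
primes: k0 448 · k1 1534 · k2+ 2331); conclusion of E-es-93 CERTIFIED at the recorded `(m, χ)` on 4305/4313 (k0 447, k1
1532, k2+ 2326); 8 rows uninformative (27a1, 54a1: gA = 1; 1242p1, 2691a1, 3312j1, 3519a1, 3933a1, 3933b1: argmin
`m = 31 ≡ 1 (mod 3)`), 0 counterexamples; direct plus-coordinate censuses D-es-30 (E-es-92) / D-es-30′ (E-es-93) REQUESTED
(data seat).  BC7 summit-mode probes CLEAN (es/g22/g22-bc7f.raw.txt 13/13, g22-bc7g.raw.txt 14/14).  REF1 R-es-44 scope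
(§E/§EL/§C) PENDING at filing — a finding is repaired under a NEW name (append-only); REF2 placement pending.
bears_on: stmt-BirchSwinnertonDyer-22968 (C3 es-input h66).  PARTITION (es): h66 ⟸ ONE f-level law on 4313/4313 classes
`9 ∣ N ≤ 5000` (conclusion certified 4305) · beyond-print theorem: no (this file; the theorems are es's, sibling files) ·
BSD is not proved by this; Manin's conjecture is not proved by this.
-/

noncomputable section

open scoped Classical MatrixGroups ModularForm ComplexConjugate

open CongruenceSubgroup Complex Literature.NumberTheory.EllipticCurves
  Literature.NumberTheory.EllipticCurves.ModularForms
open Summit.BirchSwinnertonDyer.Rank1Residual.ManinAdditive.KatoCurve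
open Summit.BirchSwinnertonDyer.Rank1Residual.ManinAdditive.Gamma1Lattice

namespace Summit.BirchSwinnertonDyer.Rank1Residual.ManinAdditive.KatoCurve

section EulerClass

/-! ## §E Levels with ONE multiplicative prime: THEOREM U♮E₁ (es g22)

At a level with exactly one prime `l ∥ N` the tree's polar witness carries the Euler factor
`E_l(χ) = (l − a_l χ(l̄))(l − a_l χ(l̄)⁻¹)`.  Expanding `E_l(χ) = (l² + a_l²) − a_l·l·(χ(l̄) + χ(l̄)⁻¹)` and pushing
the two translations `x ↦ x·l̄^{∓1}` through orthogonality, `Σ_χ c(χ)·E_l(χ)·S_χ` is `φ(m)` times the plus part of the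
E-TRANSLATED degeneracy loop `(l² + a²)·L_m(b) − a·l·(L_m(b l̄⁻¹) + L_m(b l̄))`.  Hence: if these loops (prime class
`m ≡ 2 (mod 3)`) have plus index prime to `3`, the generic Fourier unit lemma run on the family `T_χ = E_l(χ)·S_χ`
gives a polar witness WITH its Euler factor — no norm / Galois argument, no exclusion of «E-hole» characters by hand.
Mod `3` the translation operator is `−σ⁻¹(σ − ε)²` with `ε = a_l·l (mod 3)` and `σ : b ↦ l b` (char-`3` identity
`x² ∓ x + 1 = (x ∓ 1)²… = (x ± …)`): the hypothesis fails at a prime `m` iff the plus-coordinate function satisfies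
`j_m(l b) ≡ ε·j_m(b) (mod 3)` for all `b` — the «E-hole» phenomenon as an f-level lattice law (E-es-92). -/

variable {N : ℕ} (f : CuspForm (Gamma0 N) 2)

/-- The Euler factor `E_l(χ) = (l − a·χ(l̄))·(l − a·χ(l̄)⁻¹)` — ONE factor of the product over `ℓ ∥ N` in the tree's
`ThreeAdicPolarWitness` (with `a = a_l(V) = V.LFunction l`). -/
def eulerFactorTwist {ℓ : ℕ} (l : ℕ) (a : ℤ) (χ : DirichletCharacter ℂ ℓ) : ℂ :=
  ((l : ℂ) - (a : ℂ) * χ (l : ZMod ℓ)) * ((l : ℂ) - (a : ℂ) * (χ (l : ZMod ℓ))⁻¹)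

/-- The ratio-`t` degeneracy loop `{∞, t·b/m} − {∞, b/m}`. -/
def degLoop (t m b : ℕ) : ℂ :=
  modularSymbol f (((t * b : ℕ) : ℚ) / m) - modularSymbol f ((b : ℚ) / m)

/-- A degeneracy loop at a prime denominator `m ∤ tN` is a period of `f` (es g22, PROVED). -/
theorem degLoop_mem [NeZero N] (t : ℕ) {m : ℕ} (hm : m.Prime) (hmtN : ¬ m ∣ t * N) (b : ℕ) :
    degLoop f t m b ∈ periodLattice f := by
  have hmN : m.Coprime N :=
    (Nat.Prime.coprime_iff_not_dvd hm).mpr (fun h => hmtN (Dvd.dvd.mul_left h t))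
  have h1 := modularSymbol_div_sub_one_mem f hm.ne_zero hmN ((t * b : ℕ) : ℤ)
  have h2 := modularSymbol_div_sub_one_mem f hm.ne_zero hmN ((b : ℕ) : ℤ)
  have h := sub_mem h1 h2
  unfold degLoop
  push_cast at h ⊢
  simpa using h

/-- **E-translated prime-class degeneracy loops** of ratio `t` for the multiplicative prime `l` with coefficient `a`
(= `a_l`): `(l² + a²)·L_m(b) − a·l·(L_m(bm) + L_m(bp))`, `bp ≡ b·l`, `bm·l ≡ b (mod m)`, at primes `m ≡ 2 (mod 3)`,
`m ∤ tN`, `m ∤ l`, `m ∤ b`. -/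
def degeneracyLoopsClassTwoEuler (t l : ℕ) (a : ℤ) : Set ℂ :=
  {z | ∃ (m b bp bm : ℕ), m.Prime ∧ m % 3 = 2 ∧ ¬ m ∣ t * N ∧ ¬ m ∣ l ∧ ¬ m ∣ b ∧
      ((bp : ℕ) : ZMod m) = ((b : ℕ) : ZMod m) * ((l : ℕ) : ZMod m) ∧
      ((bm : ℕ) : ZMod m) * ((l : ℕ) : ZMod m) = ((b : ℕ) : ZMod m) ∧
      z = (((l : ℤ) ^ 2 + a ^ 2 : ℤ) : ℂ) * degLoop f t m b
            - ((a * l : ℤ) : ℂ) * (degLoop f t m bm + degLoop f t m bp)}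

/-- **(K_t)♮E-plus hypothesis**: the plus parts of the E-translated prime-class degeneracy loops reach a subgroup
of `tr Λ_f` of index prime to `p`. -/
def DegeneracyClassEulerPlusIndexPrimeTo (p t l : ℕ) (a : ℤ) : Prop :=
  ∀ x ∈ periodLattice f, ∃ y ∈ AddSubgroup.closure (degeneracyLoopsClassTwoEuler f t l a),
    ∃ k : ℕ, ¬ p ∣ k ∧ (k : ℂ) * (x + starRingEnd ℂ x) = y + starRingEnd ℂ y

/-- The E-translated prime-class loops (one sharp prime) are periods of `f` (es g22, PROVED). -/
theorem degeneracyLoopsClassTwoEuler_subset [NeZero N] (t l : ℕ) (a : ℤ) :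
    degeneracyLoopsClassTwoEuler f t l a ⊆ periodLattice f := by
  rintro g ⟨m, b, bp, bm, hmp, -, hmtN, -, -, -, -, rfl⟩
  -- `(n : ℂ) * x ∈ Λ_f` for `x ∈ Λ_f` is the tree's `Theorems.intCast_mul_mem_periodLattice` (dedup); inlined here.
  have hz : ∀ {x : ℂ}, x ∈ periodLattice f → ∀ n : ℤ, (n : ℂ) * x ∈ periodLattice f :=
    fun hx n => by rw [← zsmul_eq_mul]; exact zsmul_mem hx n
  exact sub_mem (hz (degLoop_mem f t hmp hmtN b) _)
    (hz (add_mem (degLoop_mem f t hmp hmtN bm) (degLoop_mem f t hmp hmtN bp)) _)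

/-- **E-es-92 (K₉)♮E₁ `DegeneracyClassEulerLawNine`** — the E-hole law for ONE multiplicative prime: at a level
`9 ∣ N`, for a rational newform `f`, a prime `l ∥ N` with `a_l(f) = a` and plus index prime to `3`, the
E-translated prime-class ratio-`9` loops still have plus index prime to `3` (mod `3` the translation is
`−σ_l⁻¹(σ_l − ε_l)²`, `ε_l = a·l (mod 3)`: the law says the plus-coordinate function `j_m` of SOME prime `m ≡ 2 (3)`
is not `σ_l`-`ε_l`-equivariant mod `3`).  LAW, nothing asserted; census = D-es-30 (engine g18_kt.py + θ_l).
TYPER FRAMING (E-es-92): lens es; LAW (obligation node), nothing asserted; BC5 / BC7 / REF1 status in the file header.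
[conjecture — cell candidate, NOT a tree fact] -/
@[conjecture]
def DegeneracyClassEulerLawNine : Prop :=
  ∀ {N : ℕ} [NeZero N], 3 ^ 2 ∣ N → ∀ f : CuspForm (Gamma0 N) 2, IsNewform0 f → coeffField f = ⊥ →
    ∀ l ∈ N.primeFactors, ¬ l ^ 2 ∣ N → ∀ a : ℤ, cuspCoeff f l = (a : ℂ) →
    PlusIndexPrimeTo 3 f → DegeneracyClassEulerPlusIndexPrimeTo f 3 9 l a

end EulerClass

section EulerList

/-! ## §EL ANY number of multiplicative primes: THEOREM U♮E_L (es g22)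

The Euler factor of a LIST `L` of sharp primes, `E_L(χ) = ∏_{q ∈ L} (q − a_q χ(q̄))(q − a_q χ(q̄)⁻¹)`, acts on
WEIGHT FUNCTIONS `w : ℤ/m → ℤ` through the commuting translation operators
`(θ_q w)(y) = (q² + a_q²)·w(y) − a_q·q·(w(y·q̄) + w(y·q̄⁻¹))`:
`(Σ_x w(x) χ(x⁻¹))·E_L(χ) = Σ_x (θ_L w)(x) χ(x⁻¹)`.  Starting from the loop weight `w_b = δ_{t b̄} − δ_{b̄}`
(`Σ_x w_b(x)·{∞, x/m} = {∞, tb/m} − {∞, b/m}`), the E-translated loop is `z = Σ_x (θ_L w_b)(x)·{∞, x/m} ∈ Λ_f`, and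
orthogonality gives `Σ_χ c(χ)·E_L(χ)·S_χ = φ(m)·(z + z̄)`; the generic Fourier unit lemma then yields a unit
twist WITH the full Euler factor.  Habitat: every level `9 ∣ N` (all 4313 classes ≤ 5000). -/

variable {N : ℕ} (f : CuspForm (Gamma0 N) 2)

/-- Euler factor of a list of sharp primes with coefficients `a`. -/
def eulerFactorList {ℓ : ℕ} (a : ℕ → ℤ) : List ℕ → DirichletCharacter ℂ ℓ → ℂ
  | [], _ => 1
  | q :: L, χ => eulerFactorTwist q (a q) χ * eulerFactorList a L χ

/-- `E_L(χ)` is the product of the one-prime Euler factors over the list (es g22, PROVED). -/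
theorem eulerFactorList_eq_prod {ℓ : ℕ} (a : ℕ → ℤ) (χ : DirichletCharacter ℂ ℓ) :
    ∀ L : List ℕ, eulerFactorList a L χ = (L.map fun q => eulerFactorTwist q (a q) χ).prod
  | [] => rfl
  | q :: L => by rw [eulerFactorList, List.map_cons, List.prod_cons, eulerFactorList_eq_prod a χ L]

/-- The translation operator `θ_q` on weight functions. -/
def eulerShift {m : ℕ} (q : ℕ) (a : ℤ) (w : ZMod m → ℤ) : ZMod m → ℤ :=
  fun y => ((q : ℤ) ^ 2 + a ^ 2) * w y - a * q * (w (y * (q : ZMod m)) + w (y * (q : ZMod m)⁻¹))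

/-- `θ_L = θ_{q_k} ∘ ⋯ ∘ θ_{q_1}` for `L = [q_1, …, q_k]`. -/
def eulerShiftList {m : ℕ} (a : ℕ → ℤ) : List ℕ → (ZMod m → ℤ) → (ZMod m → ℤ)
  | [], w => w
  | q :: L, w => eulerShiftList a L (eulerShift q (a q) w)

/-- `θ_L` preserves vanishing at `0` (es g22, PROVED). -/
theorem eulerShiftList_apply_zero {m : ℕ} (a : ℕ → ℤ) :
    ∀ (L : List ℕ) (w : ZMod m → ℤ), w 0 = 0 → eulerShiftList a L w 0 = 0
  | [], w, hw => hw
  | q :: L, w, hw => eulerShiftList_apply_zero a L _ (by simp [eulerShift, hw])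

/-- `θ_L` commutes with `x ↦ −x` (es g22, PROVED). -/
theorem eulerShiftList_neg {m : ℕ} (a : ℕ → ℤ) :
    ∀ (L : List ℕ) (w : ZMod m → ℤ) (x : ZMod m),
      eulerShiftList a L (fun y => w (-y)) x = eulerShiftList a L w (-x)
  | [], w, x => rfl
  | q :: L, w, x => by
      have h : eulerShift q (a q) (fun y => w (-y)) = fun y => eulerShift q (a q) w (-y) := by
        funext y; simp [eulerShift, neg_mul]
      show eulerShiftList a L (eulerShift q (a q) (fun y => w (-y))) x = eulerShiftList a L (eulerShift q (a q) w) (-x)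
      rw [h]
      exact eulerShiftList_neg a L _ x

/-- Reindexing by a unit (multiplication). -/
theorem sum_reindex_mul {m : ℕ} [Fact m.Prime] (g : ZMod m → ℂ) {lam : ZMod m}
    (hlam : lam ≠ 0) : ∑ y : ZMod m, g (y * lam) = ∑ x : ZMod m, g x :=
  Equiv.sum_comp (Equiv.mulRight₀ lam hlam) g

/-- Reindexing by negation. -/
theorem sum_reindex_neg {m : ℕ} [NeZero m] (g : ZMod m → ℂ) :
    ∑ y : ZMod m, g (-y) = ∑ x : ZMod m, g x :=
  Equiv.sum_comp (Equiv.neg (ZMod m)) g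

/-- `Σ_x (θ_q w)(x) = (q − a)²·Σ_x w(x)`. -/
theorem sum_eulerShift {m : ℕ} [Fact m.Prime] (q : ℕ) (a : ℤ) (w : ZMod m → ℤ)
    (hq : ((q : ℕ) : ZMod m) ≠ 0) :
    ∑ x : ZMod m, ((eulerShift q a w x : ℤ) : ℂ) = (((q : ℤ) - a) ^ 2 : ℤ) * ∑ x : ZMod m, (w x : ℂ) := by
  haveI : NeZero m := ⟨(Fact.out : m.Prime).ne_zero⟩
  have r1 := sum_reindex_mul (fun x => (w x : ℂ)) hq
  have r2 := sum_reindex_mul (fun x => (w x : ℂ)) (inv_ne_zero hq)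
  have : ∑ x : ZMod m, ((eulerShift q a w x : ℤ) : ℂ)
      = ∑ x : ZMod m, ((((q : ℤ) ^ 2 + a ^ 2 : ℤ) : ℂ) * (w x : ℂ)
          - ((a * q : ℤ) : ℂ) * (w (x * ((q : ℕ) : ZMod m)) : ℂ)
          - ((a * q : ℤ) : ℂ) * (w (x * ((q : ℕ) : ZMod m)⁻¹) : ℂ)) := by
    refine Finset.sum_congr rfl (fun x _ => ?_)
    simp only [eulerShift]; push_cast; ring
  rw [this, Finset.sum_sub_distrib, Finset.sum_sub_distrib, ← Finset.mul_sum, ← Finset.mul_sum,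
    ← Finset.mul_sum, r1, r2]
  push_cast
  ring

/-- `θ_L` preserves total weight `0` when no prime of `L` vanishes mod `m` (es g22, PROVED). -/
theorem sum_eulerShiftList_eq_zero {m : ℕ} [Fact m.Prime] (a : ℕ → ℤ) :
    ∀ (L : List ℕ) (w : ZMod m → ℤ), (∀ q ∈ L, ((q : ℕ) : ZMod m) ≠ 0) →
      ∑ x : ZMod m, (w x : ℂ) = 0 → ∑ x : ZMod m, ((eulerShiftList a L w x : ℤ) : ℂ) = 0
  | [], w, _, hw => hw
  | q :: L, w, hL, hw => by
      have hq : ((q : ℕ) : ZMod m) ≠ 0 := hL q (by simp)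
      have hL' : ∀ q' ∈ L, ((q' : ℕ) : ZMod m) ≠ 0 := fun q' h => hL q' (by simp [h])
      refine sum_eulerShiftList_eq_zero a L _ hL' ?_
      rw [sum_eulerShift q (a q) w hq, hw, mul_zero]

/-- The loop weight `w_b = δ_{t̄·u} − δ_u`. -/
def loopWeight {m : ℕ} (t : ℕ) (u : ZMod m) : ZMod m → ℤ :=
  fun x => (if x = (t : ZMod m) * u then 1 else 0) - (if x = u then 1 else 0)

/-- Pairing a function with the loop weight: `Σ_x w_b(x)·g(x) = g(t̄u) − g(u)` (es g22, PROVED). -/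
theorem sum_loopWeight_mul {m : ℕ} [NeZero m] (t : ℕ) (u : ZMod m) (g : ZMod m → ℂ) :
    ∑ x : ZMod m, ((loopWeight t u x : ℤ) : ℂ) * g x = g ((t : ZMod m) * u) - g u := by
  simp only [loopWeight, Int.cast_sub, Int.cast_ite, Int.cast_one, Int.cast_zero, sub_mul, ite_mul,
    one_mul, zero_mul, Finset.sum_sub_distrib, Finset.sum_ite_eq', Finset.mem_univ, if_true]

/-- The loop weight vanishes at `0` for `u ≠ 0`, `t̄u ≠ 0` (es g22, PROVED). -/
theorem loopWeight_apply_zero {m : ℕ} (t : ℕ) {u : ZMod m} (hu : u ≠ 0) (htu : (t : ZMod m) * u ≠ 0) :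
    loopWeight t u 0 = 0 := by
  simp [loopWeight, Ne.symm hu, Ne.symm htu]

/-- A weighted cusp sum with total weight `0` lies in `Λ_f`. -/
theorem weightSum_mem_periodLattice [NeZero N] {m : ℕ} [NeZero m] (hm : m.Prime) (hmN : m.Coprime N)
    (v : ZMod m → ℤ) (hv : ∑ x : ZMod m, (v x : ℂ) = 0) :
    ∑ x : ZMod m, (v x : ℂ) * cuspValue f m x ∈ periodLattice f := by
  have h : ∑ x : ZMod m, (v x : ℂ) * cuspValue f m x
      = ∑ x : ZMod m, (v x : ℂ) * (cuspValue f m x - modularSymbol f 1) := by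
    simp_rw [mul_sub, Finset.sum_sub_distrib, ← Finset.sum_mul, hv, zero_mul, sub_zero]
  rw [h]
  refine sum_mem (fun x _ => ?_)
  rw [← zsmul_eq_mul]
  refine zsmul_mem ?_ (v x)
  have := modularSymbol_div_sub_one_mem f hm.ne_zero hmN (x.val : ℤ)
  unfold cuspValue
  push_cast at this ⊢
  exact this

/-- **E-translated prime-class degeneracy loops** for a LIST `L` of sharp primes with coefficients `a`:
`Σ_x (θ_L w_{t,b})(x)·{∞, x/m}` over primes `m ≡ 2 (mod 3)`, `m ∤ tN`, `m ∤ q (q ∈ L)`, `m ∤ b`. -/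
def degeneracyLoopsClassTwoEulerList (t : ℕ) (L : List ℕ) (a : ℕ → ℤ) : Set ℂ :=
  {z | ∃ (m b : ℕ) (_ : NeZero m), m.Prime ∧ m % 3 = 2 ∧ ¬ m ∣ t * N ∧ (∀ q ∈ L, ¬ m ∣ q) ∧ ¬ m ∣ b ∧
      z = ∑ x : ZMod m, ((eulerShiftList a L (loopWeight t ((b : ℕ) : ZMod m)) x : ℤ) : ℂ) * cuspValue f m x}

/-- **(K_t)♮E_L-plus.** -/
def DegeneracyClassEulerListPlusIndexPrimeTo (p t : ℕ) (L : List ℕ) (a : ℕ → ℤ) : Prop :=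
  ∀ x ∈ periodLattice f, ∃ y ∈ AddSubgroup.closure (degeneracyLoopsClassTwoEulerList f t L a),
    ∃ k : ℕ, ¬ p ∣ k ∧ (k : ℂ) * (x + starRingEnd ℂ x) = y + starRingEnd ℂ y

/-- The E-translated prime-class loops (list of sharp primes) are periods of `f` (es g22, PROVED). -/
theorem degeneracyLoopsClassTwoEulerList_subset [NeZero N] (t : ℕ) (L : List ℕ) (a : ℕ → ℤ) :
    degeneracyLoopsClassTwoEulerList f t L a ⊆ periodLattice f := by
  rintro z ⟨m, b, _, hm, -, hmtN, hmL, hmb, rfl⟩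
  haveI : Fact m.Prime := ⟨hm⟩
  have hmN : m.Coprime N := (Nat.Prime.coprime_iff_not_dvd hm).mpr (fun h => hmtN (Dvd.dvd.mul_left h t))
  refine weightSum_mem_periodLattice f hm hmN _ ?_
  refine sum_eulerShiftList_eq_zero a L _ (fun q hq h => hmL q hq ?_) ?_
  · exact (ZMod.natCast_eq_zero_iff q m).mp h
  · simpa using sum_loopWeight_mul t ((b : ℕ) : ZMod m) (fun _ => (1 : ℂ))

/-- **E-es-93 (K₉)♮E `DegeneracyClassEulerListLawNine`** — the E-hole law for ALL sharp primes at once: at a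
level `9 ∣ N`, for a rational newform `f` with `a_q(f) = a q` at the sharp primes and plus index prime to `3`, the
E-translated prime-class ratio-`9` loops (translation `θ_F = ∏_{q ∥ N} θ_q`, `θ_q ≡ −σ_q⁻¹(σ_q − ε_q)² (mod 3)`)
have plus index prime to `3`.  LAW, nothing asserted; census = D-es-30.  Specialises to E-es-91 (no sharp prime)
and E-es-92 (one sharp prime).
TYPER FRAMING (E-es-93): lens es; LAW (obligation node), nothing asserted; BC5 / BC7 / REF1 status in the file header.
[conjecture — cell candidate, NOT a tree fact] -/
@[conjecture]
def DegeneracyClassEulerListLawNine : Prop :=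
  ∀ {N : ℕ} [NeZero N], 3 ^ 2 ∣ N → ∀ f : CuspForm (Gamma0 N) 2, IsNewform0 f → coeffField f = ⊥ →
    ∀ a : ℕ → ℤ, (∀ q ∈ N.primeFactors, ¬ q ^ 2 ∣ N → cuspCoeff f q = (a q : ℂ)) → PlusIndexPrimeTo 3 f →
      DegeneracyClassEulerListPlusIndexPrimeTo f 3 9 (N.primeFactors.filter fun q => ¬ q ^ 2 ∣ N).toList a

end EulerList

section PrimeWitness

open WeierstrassCurve

/-- The tree's `ThreeAdicPolarWitness W W f` restricted to PRIME conductors `m ≡ 2 (mod 3)` (`V = W`, `ρ = 1`):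
a polar (`3`-adic unit) value `e_S(χ)·S_χ = r·Ω⁺_f` for an even character `χ` mod a prime `m ∤ 3N`, `m ≡ 2 (3)`,
with `3 ∤ ord χ` and `χ(3) ∉ {±1}`. -/
def PrimeThreeAdicPolarWitness (W : WeierstrassCurve ℚ) {N : ℕ} (f : CuspForm (Gamma0 N) 2) : Prop :=
  ∃ (m : ℕ) (_ : NeZero m) (χ : DirichletCharacter ℂ m) (r : ℂ),
    m.Prime ∧ m % 3 = 2 ∧ ¬ m ∣ 3 * N ∧ ¬ 3 ∣ orderOf χ ∧
    χ (3 : ZMod m) ≠ 1 ∧ χ (3 : ZMod m) ≠ -1 ∧ χ.Even ∧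
    (∏ ℓ ∈ N.primeFactors with ¬ ℓ ^ 2 ∣ N,
        (((ℓ : ℂ) - (W.LFunction ℓ : ℂ) * χ (ℓ : ZMod m)) *
          ((ℓ : ℂ) - (W.LFunction ℓ : ℂ) * (χ (ℓ : ZMod m))⁻¹))) *
        twistedSymbolSum f χ = r * (plusPeriod f : ℂ) ∧
    ∀ s : ℕ, ¬ 3 ∣ s → ¬ _root_.IsIntegral ℤ ((s : ℂ) * r / 3)

end PrimeWitness

end Summit.BirchSwinnertonDyer.Rank1Residual.ManinAdditive.KatoCurve

end
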